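import Summits.CriticalPhenomena.PercolationContinuityZ3.Theorems.PercNearOneGluingNoHeavyPcintOSMSiteRenewal
import Summits.CriticalPhenomena.PercolationContinuityZ3.Theorems.PercNearOneGluingNoHeavyPcintOSMBridge
import Literature.Probability.Percolation.SitePercolationMeasure
import Literature.Probability.Percolation.SiteMonotonicity
import Literature.Probability.Percolation.SiteConnectionTools
import HarnessLib

/-!
# PCINT lane, PHASE 4 (kernel second-moment oriented route), site version, step 2: the bridge to site percolation on `ℤ^d`

Cell `prim-pcint`, seat `prim-pcint-1` (gen 13); memo `run/shared/lean/prim/pcint/T-FIBRE-ROUTE.md` §PHASE 4.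

The SITE analogue of `…OSMBridge`: the sites met by oriented paths of length `n` from the origin (the origin and the
positions at times `1, …, n`) are indexed by the finite set `OSM.vsites d n`; the event "the origin is open and some
oriented path of length `n` has all its sites open" (`OSM.orientedSiteEvent`) is determined by them; on the finite product
space (`OSM.site_real_eq_sum`, from the tree's `sitePercolation_real_eq_sum`)

  `E N = d^n p^{n+1}`, `E N² = p^{2n+1} · SV d (1/p) n 0`, `P(N ≥ 1) ≥ (E N)²/E N²`,

so `P_p(orientedSiteEvent) ≥ p · d^{2n} / SV d (1/p) n 0` (`OSM.le_real_orientedSiteEvent`), and an open oriented path of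
length `n` from the open origin realises the exit event of the graph ball `B(0, n)` (**`OSM.le_real_exitEvent`**).
-/

noncomputable section

namespace Summit.CriticalPhenomena.PercolationContinuityZ3.Theorems.Pcint.OSM

open Finset MeasureTheory AdaptDom Literature.Probability.Percolation Literature.Probability.LatticeModels

variable {d n : ℕ}

/-! ### The site parametrisation -/

/-- The origin and the sites visited at times `1, …, n` by some oriented word. -/
def vsites (d n : ℕ) : Finset (Site d) :=
  insert 0 ((univ : Finset (Fin n × (Fin n → Fin d))).image fun q => pos q.2 ((q.1 : ℕ) + 1))

/-- The index type of the sites in play. -/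
abbrev VIdx (d n : ℕ) := ↥(vsites d n)

/-- The origin as an index. -/
def vorig : VIdx d n := ⟨0, mem_insert_self _ _⟩

/-- The index of the site of `w` at time `i + 1`. -/
def vidx (w : Fin n → Fin d) (i : Fin n) : VIdx d n :=
  ⟨pos w ((i : ℕ) + 1), mem_insert_of_mem (mem_image.2 ⟨(i, w), mem_univ _, rfl⟩)⟩

/-- Sites at positive times are not the origin. -/
theorem vidx_ne_vorig (w : Fin n → Fin d) (i : Fin n) : vidx w i ≠ (vorig : VIdx d n) := by
  intro h
  have h1 : pos w ((i : ℕ) + 1) = 0 := congr_arg Subtype.val h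
  have := congr_arg (fun z : Site d => ∑ j, z j) h1
  simp only [level w (Nat.succ_le_of_lt i.2), Pi.zero_apply, Finset.sum_const_zero] at this
  norm_cast at this

/-- Equal indices sit at the same time. -/
theorem eq_of_vidx_eq {w w' : Fin n → Fin d} {i i' : Fin n} (h : vidx w i = vidx w' i') : i = i' := by
  have h1 : pos w ((i : ℕ) + 1) = pos w' ((i' : ℕ) + 1) := congr_arg Subtype.val h
  have := congr_arg (fun z : Site d => ∑ j, z j) h1
  simp only [level w (Nat.succ_le_of_lt i.2), level w' (Nat.succ_le_of_lt i'.2)] at this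
  norm_cast at this
  exact Fin.ext (by omega)

/-- `vidx w` is injective. -/
theorem vidx_injective (w : Fin n → Fin d) : Function.Injective (vidx w) := fun _ _ h => eq_of_vidx_eq h

/-- Equal indices at the same time: same position. -/
theorem vidx_eq_iff {w w' : Fin n → Fin d} {i : Fin n} :
    vidx w i = vidx w' i ↔ pos w ((i : ℕ) + 1) = pos w' ((i : ℕ) + 1) :=
  ⟨fun h => congr_arg Subtype.val h, fun h => Subtype.ext h⟩

/-- The site indices of a word: the origin and the sites at times `1, …, n`. -/
def vsetOf (w : Fin n → Fin d) : Finset (VIdx d n) := insert vorig (univ.image (vidx w))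

/-- A word has `n + 1` sites. -/
theorem card_vsetOf (w : Fin n → Fin d) : (vsetOf w).card = n + 1 := by
  rw [vsetOf, Finset.card_insert_of_notMem, Finset.card_image_of_injective _ (vidx_injective w), card_univ,
    Fintype.card_fin]
  intro h
  obtain ⟨i, -, hi⟩ := mem_image.1 h
  exact vidx_ne_vorig w i hi

/-- **Shared sites**: `|V(w) ∩ V(w')| = KV 0 w w' + 1`. -/
theorem card_vinter (w w' : Fin n → Fin d) : (vsetOf w ∩ vsetOf w').card = KV 0 w w' + 1 := by
  have hset : vsetOf w ∩ vsetOf w' = insert vorig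
      ((univ.filter fun i : Fin n => (0 : Site d) + pos w ((i : ℕ) + 1) = pos w' ((i : ℕ) + 1)).image (vidx w)) := by
    ext y
    simp only [vsetOf, mem_inter, mem_insert, mem_image, mem_univ, true_and, mem_filter, zero_add]
    constructor
    · rintro ⟨h1 | ⟨i, hi⟩, h2 | ⟨i', hi'⟩⟩
      · exact Or.inl h1
      · exact Or.inl h1
      · exact Or.inl h2
      · right
        have hii : i = i' := eq_of_vidx_eq (hi.trans hi'.symm)
        subst hii
        exact ⟨i, vidx_eq_iff.1 (hi.trans hi'.symm), hi⟩
    · rintro (h | ⟨i, hi, rfl⟩)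
      · exact ⟨Or.inl h, Or.inl h⟩
      · exact ⟨Or.inr ⟨i, rfl⟩, Or.inr ⟨i, (vidx_eq_iff.2 hi).symm⟩⟩
  rw [hset, Finset.card_insert_of_notMem, Finset.card_image_of_injective _ (vidx_injective w), KV]
  intro h
  obtain ⟨i, -, hi⟩ := mem_image.1 h
  exact vidx_ne_vorig w i hi

/-! ### The event, its determination and its place in the exit event -/

/-- **The origin is open and some oriented path of length `n` from it has all its sites open.** -/
def orientedSiteEvent (d n : ℕ) : Set (SiteConfig (Site d)) :=
  {ω | (0 : Site d) ∈ ω ∧ ∃ w : Fin n → Fin d, ∀ i : Fin n, pos w ((i : ℕ) + 1) ∈ ω}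

/-- The event is determined by the sites in play. -/
theorem determinedBy_orientedSiteEvent : DeterminedBy (orientedSiteEvent d n) (↑(vsites d n) : Set (Site d)) := by
  rw [determinedBy_iff]
  intro ω ω' h
  have key : ∀ v ∈ vsites d n, v ∈ ω ↔ v ∈ ω' := by
    intro v hv
    constructor
    · intro hω; have : v ∈ ω ∩ ↑(vsites d n) := ⟨hω, hv⟩; rw [h] at this; exact this.1
    · intro hω; have : v ∈ ω' ∩ ↑(vsites d n) := ⟨hω, hv⟩; rw [← h] at this; exact this.1
  simp only [orientedSiteEvent, Set.mem_setOf_eq]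
  rw [key 0 (mem_insert_self _ _)]
  refine and_congr_right fun _ => exists_congr fun w => forall_congr' fun i => key _ (vidx w i).2

/-- **An open oriented path of length `n` from the open origin realises the exit event of the ball `B(0, n)`.** -/
theorem exitEvent_of_orientedSiteEvent [NeZero d] {ω : SiteConfig (Site d)} (h : ω ∈ orientedSiteEvent d n) :
    ω ∈ exitEvent (zdGraph d) (DCTQ.ball (zdGraph d) (0 : Site d) n) (0 : Site d) := by
  obtain ⟨h0, w, hw⟩ := h
  set Λ := DCTQ.ball (zdGraph d) (0 : Site d) n with hΛ
  -- positions stay in the ball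
  have hball : ∀ i, i ≤ n → pos w i ∈ DCTQ.ball (zdGraph d) (0 : Site d) i := by
    intro i hi
    induction i with
    | zero => rw [pos_zero]; exact DCTQ.mem_ball_self _ _
    | succ i ih =>
      have hi' : i < n := Nat.lt_of_succ_le hi
      rw [pos_succ w hi']
      exact DCTQ.mem_ball_succ_of_adj (ih hi'.le) ((zdGraph_adj_iff _ _).2 ⟨w ⟨i, hi'⟩, Or.inl rfl⟩)
  have hmemΛ : ∀ i, i ≤ n → pos w i ∈ (↑Λ : Set (Site d)) := fun i hi =>
    mem_coe.2 (DCTQ.ball_mono 0 hi (hball i hi))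
  have hopen : ∀ i, i ≤ n → pos w i ∈ ω := by
    intro i hi
    rcases Nat.eq_zero_or_pos i with h | h
    · subst h; rw [pos_zero]; exact h0
    · obtain ⟨j, rfl⟩ : ∃ j, i = j + 1 := ⟨i - 1, by omega⟩
      exact hw ⟨j, by omega⟩
  -- the open path inside the ball
  have hconn : ∀ i, i ≤ n → ω ∈ siteConnIn (zdGraph d) ↑Λ (0 : Site d) (pos w i) := by
    intro i hi
    induction i with
    | zero =>
      rw [pos_zero]
      exact mem_siteConnIn_self _ h0 (mem_coe.2 (DCTQ.mem_ball_self _ _))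
    | succ i ih =>
      have hi' : i < n := Nat.lt_of_succ_le hi
      refine siteConnIn_trans _ subset_rfl subset_rfl (ih hi'.le) ?_
      refine mem_siteConnIn_of_adj _ (hopen i hi'.le) (hopen (i + 1) hi) (hmemΛ i hi'.le) (hmemΛ (i + 1) hi) ?_
      rw [pos_succ w hi']
      exact (zdGraph_adj_iff _ _).2 ⟨w ⟨i, hi'⟩, Or.inl rfl⟩
  -- the endpoint lies on the inner boundary: its neighbour `+ e_0` is outside the ball
  refine mem_exitEvent_iff.2 ⟨pos w n, ?_, hconn n le_rfl⟩
  have hd : 0 < d := Nat.pos_of_ne_zero (NeZero.ne d)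
  refine mem_innerBoundary_iff.2 ⟨hball n le_rfl, pos w n + e ⟨0, hd⟩, fun hmem => ?_,
    (zdGraph_adj_iff _ _).2 ⟨⟨0, hd⟩, Or.inl rfl⟩⟩
  have h1 := norm_le_of_mem_ball n _ hmem
  have h2 : ∑ j, |(pos w n + e ⟨0, hd⟩) j| = (n : ℤ) + 1 := by
    have : ∀ j, |(pos w n + e ⟨0, hd⟩) j| = pos w n j + e ⟨0, hd⟩ j := fun j =>
      abs_of_nonneg (add_nonneg (pos_nonneg w n j) (by simp only [e, Pi.single_apply]; split_ifs <;> norm_num))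
    simp_rw [this, Finset.sum_add_distrib, level w le_rfl, e, Finset.sum_pi_single', mem_univ, if_true]
  rw [h2] at h1
  linarith

/-! ### The finite-sum formula for the site measure -/

/-- The site configuration of a Boolean assignment on the sites in play. -/
def liftB (a : VIdx d n → Bool) : SiteConfig (Site d) := {v | ∃ h : v ∈ vsites d n, a ⟨v, h⟩ = true}

/-- Membership of a site in play in the lifted configuration. -/
theorem mem_liftB (a : VIdx d n → Bool) (y : VIdx d n) : (y : Site d) ∈ liftB a ↔ a y = true :=
  ⟨fun ⟨_, h⟩ => h, fun h => ⟨y.2, h⟩⟩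

/-- Boolean and propositional assignments on the sites in play. -/
def boolCfgEquiv : (VIdx d n → Bool) ≃ (VIdx d n → Prop) where
  toFun a := fun v => a v = true
  invFun y := fun v => @decide (y v) (Classical.dec _)
  left_inv a := by funext v; simp
  right_inv y := by funext v; simp

/-- The tree's site weight of a Boolean assignment is the product weight `wt`. -/
theorem siteWeight_boolCfgEquiv (p : unitInterval) (a : VIdx d n → Bool) :
    siteWeight p (boolCfgEquiv a) = wt (p : ℝ) a := by
  unfold siteWeight wt bern
  refine Finset.prod_congr rfl fun v _ => ?_
  change (bernoulliProp p).real {a v = true} = if a v = true then (p : ℝ) else 1 - p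
  cases hv : a v
  · simp
  · simp

open Classical in
/-- **`P_p` dominates the finite sum over Boolean assignments on the sites in play** (in fact equality holds; the
inequality is what the second-moment method needs). -/
theorem sum_le_site_real (p : unitInterval) {A : Set (SiteConfig (Site d))}
    (hA : DeterminedBy A (↑(vsites d n) : Set (Site d))) :
    ∑ a : VIdx d n → Bool, wt (p : ℝ) a * (if liftB a ∈ A then (1 : ℝ) else 0) ≤
      (sitePercolation (Site d) p).real A := by
  rw [sitePercolation_real_eq_sum p hA]
  have hiff : ∀ a : VIdx d n → Bool, boolCfgEquiv a ∈ traceEvent (vsites d n) A ↔ liftB a ∈ A := by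
    intro a
    unfold traceEvent liftSiteConfig liftB boolCfgEquiv
    exact Iff.rfl
  have step1 : ∑ a : VIdx d n → Bool, wt (p : ℝ) a * (if liftB a ∈ A then (1 : ℝ) else 0) =
      ∑ a ∈ univ.filter (fun a : VIdx d n → Bool => liftB a ∈ A), wt (p : ℝ) a := by
    rw [Finset.sum_filter]
    refine Finset.sum_congr rfl fun a _ => ?_
    split_ifs <;> simp
  have step2 : ∑ a ∈ univ.filter (fun a : VIdx d n → Bool => liftB a ∈ A), wt (p : ℝ) a =
      ∑ y ∈ (univ.filter (fun a : VIdx d n → Bool => liftB a ∈ A)).map boolCfgEquiv.toEmbedding, siteWeight p y := by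
    rw [Finset.sum_map]
    exact Finset.sum_congr rfl fun a _ => by rw [Equiv.coe_toEmbedding, siteWeight_boolCfgEquiv]
  rw [step1, step2]
  refine Finset.sum_le_sum_of_subset_of_nonneg ?_ fun y _ _ => siteWeight_nonneg p y
  intro y hy
  rw [Finset.mem_map] at hy
  obtain ⟨a, ha, rfl⟩ := hy
  exact mem_filter.2 ⟨by simp, (hiff a).2 (mem_filter.1 ha).2⟩

/-! ### Open words and the two moments -/

/-- The weight of "all bits of `S` set" is `p^{|S|}` (any finite index type). -/
theorem sum_wt_all' {Y : Type*} [Fintype Y] [DecidableEq Y] (p : ℝ) (S : Finset Y) :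
    ∑ a : Y → Bool, wt p a * (if ∀ y ∈ S, a y = true then (1 : ℝ) else 0) = p ^ S.card := by
  rw [← Finset.sum_filter_of_ne (p := fun a => ∀ y ∈ S, a y = true) (fun a _ h => by
    by_contra hh; exact h (by rw [if_neg hh, mul_zero]))]
  have : ∑ a ∈ univ.filter (fun a : Y → Bool => ∀ y ∈ S, a y = true), wt p a * (if ∀ y ∈ S, a y = true then (1 : ℝ) else 0) =
      ∑ a ∈ univ.filter (fun a : Y → Bool => ∀ y ∈ S, a y = (fun _ => true) y), wt p a := by
    refine Finset.sum_congr (by rfl) fun a ha => ?_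
    rw [if_pos (mem_filter.1 ha).2, mul_one]
  rw [this, sum_wt_filter_agree, Finset.prod_const]
  rfl

/-- The lifted configuration lies in the event iff some word has all its sites (and the origin) set. -/
theorem liftB_mem_iff (a : VIdx d n → Bool) :
    liftB a ∈ orientedSiteEvent d n ↔ ∃ w : Fin n → Fin d, ∀ y ∈ vsetOf w, a y = true := by
  simp only [orientedSiteEvent, Set.mem_setOf_eq, vsetOf, mem_insert, mem_image, mem_univ, true_and,
    forall_eq_or_imp, forall_exists_index, forall_apply_eq_imp_iff]
  rw [show ((0 : Site d) ∈ liftB a) = (a vorig = true) from propext (mem_liftB a vorig)]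
  have e2 : ∀ (w : Fin n → Fin d) (i : Fin n), pos w ((i : ℕ) + 1) ∈ liftB a ↔ a (vidx w i) = true :=
    fun w i => mem_liftB a (vidx w i)
  simp only [e2]
  constructor
  · rintro ⟨h0, w, hw⟩; exact ⟨w, h0, hw⟩
  · rintro ⟨w, h0, hw⟩; exact ⟨h0, w, hw⟩

/-- **The number of open words (sites).** -/
def NV (a : VIdx d n → Bool) : ℝ := ∑ w : Fin n → Fin d, if ∀ y ∈ vsetOf w, a y = true then 1 else 0

/-- `NV = NV · 𝟙[some word is open]`. -/
theorem NV_mul_indicator (a : VIdx d n → Bool) :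
    NV a * (if ∃ w : Fin n → Fin d, ∀ y ∈ vsetOf w, a y = true then 1 else 0) = NV a := by
  split_ifs with h
  · rw [mul_one]
  · push Not at h
    have : NV a = 0 := Finset.sum_eq_zero fun w _ => by
      rw [if_neg]; obtain ⟨y, hy, hne⟩ := h w; exact fun hh => hne (hh y hy)
    rw [this, zero_mul]

/-- **First moment (sites)**: `Σ_a π_p(a) NV(a) = d^n p^{n+1}`. -/
theorem first_moment_site (p : ℝ) : ∑ a : VIdx d n → Bool, wt p a * NV a = (d : ℝ) ^ n * p ^ (n + 1) := by
  unfold NV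
  simp_rw [Finset.mul_sum]
  rw [Finset.sum_comm]
  have : ∀ w : Fin n → Fin d, ∑ a : VIdx d n → Bool, wt p a * (if ∀ y ∈ vsetOf w, a y = true then (1 : ℝ) else 0) =
      p ^ (n + 1) := by
    intro w; rw [sum_wt_all', card_vsetOf]
  simp_rw [this]
  rw [Finset.sum_const, card_univ, Fintype.card_fun, Fintype.card_fin, Fintype.card_fin, nsmul_eq_mul]
  push_cast; ring

/-- **Second moment (sites)**: `Σ_a π_p(a) NV(a)² = p^{2n+1} · SV d (1/p) n 0` (for `p > 0`). -/
theorem second_moment_site {p : ℝ} (hp : 0 < p) :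
    ∑ a : VIdx d n → Bool, wt p a * NV a ^ 2 = p ^ (2 * n + 1) * SV d (1 / p) n 0 := by
  unfold NV SV
  have hsq : ∀ a : VIdx d n → Bool, (∑ w : Fin n → Fin d, if ∀ y ∈ vsetOf w, a y = true then (1 : ℝ) else 0) ^ 2 =
      ∑ w : Fin n → Fin d, ∑ w' : Fin n → Fin d,
        if ∀ y ∈ vsetOf w ∪ vsetOf w', a y = true then (1 : ℝ) else 0 := by
    intro a
    rw [sq, Finset.sum_mul_sum]
    refine Finset.sum_congr rfl fun w _ => Finset.sum_congr rfl fun w' _ => ?_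
    by_cases h1 : ∀ y ∈ vsetOf w, a y = true
    · by_cases h2 : ∀ y ∈ vsetOf w', a y = true
      · rw [if_pos h1, if_pos h2, if_pos (fun y hy => (mem_union.1 hy).elim (h1 y) (h2 y)), one_mul]
      · rw [if_neg h2, mul_zero, if_neg (fun h => h2 fun y hy => h y (mem_union_right _ hy))]
    · rw [if_neg h1, zero_mul, if_neg (fun h => h1 fun y hy => h y (mem_union_left _ hy))]
  simp_rw [hsq, Finset.mul_sum]
  rw [Finset.sum_comm]
  refine Finset.sum_congr rfl fun w _ => ?_
  rw [Finset.sum_comm]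
  refine Finset.sum_congr rfl fun w' _ => ?_
  rw [sum_wt_all', Finset.card_union, card_vsetOf, card_vsetOf, card_vinter]
  have hK : KV 0 w w' ≤ n := by
    rw [KV]; exact (Finset.card_filter_le _ _).trans (by rw [card_univ, Fintype.card_fin])
  rw [one_div, inv_pow, ← div_eq_mul_inv, eq_div_iff (pow_ne_zero _ hp.ne'), ← pow_add]
  congr 1; omega

/-- **Cauchy–Schwarz (sites)**: `(Σ π NV)² ≤ (Σ π NV²) · (Σ π 𝟙[NV ≥ 1])`. -/
theorem moment_ineq_site {p : ℝ} (hp0 : 0 ≤ p) (hp1 : p ≤ 1) :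
    (∑ a : VIdx d n → Bool, wt p a * NV a) ^ 2 ≤
      (∑ a : VIdx d n → Bool, wt p a * NV a ^ 2) *
        ∑ a : VIdx d n → Bool, wt p a *
          (if ∃ w : Fin n → Fin d, ∀ y ∈ vsetOf w, a y = true then (1 : ℝ) else 0) := by
  have hw : ∀ a : VIdx d n → Bool, 0 ≤ wt p a := wt_nonneg hp0 hp1
  have key := Finset.sum_mul_sq_le_sq_mul_sq (univ : Finset (VIdx d n → Bool))
    (fun a => Real.sqrt (wt p a) * NV a)
    (fun a => Real.sqrt (wt p a) * (if ∃ w : Fin n → Fin d, ∀ y ∈ vsetOf w, a y = true then (1 : ℝ) else 0))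
  have e1 : ∀ a : VIdx d n → Bool, Real.sqrt (wt p a) * NV a *
      (Real.sqrt (wt p a) * (if ∃ w : Fin n → Fin d, ∀ y ∈ vsetOf w, a y = true then (1 : ℝ) else 0)) = wt p a * NV a := by
    intro a
    calc Real.sqrt (wt p a) * NV a *
          (Real.sqrt (wt p a) * (if ∃ w : Fin n → Fin d, ∀ y ∈ vsetOf w, a y = true then (1 : ℝ) else 0))
        = (Real.sqrt (wt p a) * Real.sqrt (wt p a)) *
            (NV a * (if ∃ w : Fin n → Fin d, ∀ y ∈ vsetOf w, a y = true then (1 : ℝ) else 0)) := by ring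
      _ = wt p a * NV a := by rw [Real.mul_self_sqrt (hw a), NV_mul_indicator]
  have e2 : ∀ a : VIdx d n → Bool, (Real.sqrt (wt p a) * NV a) ^ 2 = wt p a * NV a ^ 2 := by
    intro a; rw [mul_pow, Real.sq_sqrt (hw a)]
  have e3 : ∀ a : VIdx d n → Bool,
      (Real.sqrt (wt p a) * (if ∃ w : Fin n → Fin d, ∀ y ∈ vsetOf w, a y = true then (1 : ℝ) else 0)) ^ 2 =
        wt p a * (if ∃ w : Fin n → Fin d, ∀ y ∈ vsetOf w, a y = true then (1 : ℝ) else 0) := by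
    intro a; rw [mul_pow, Real.sq_sqrt (hw a)]; split_ifs <;> simp
  simp_rw [e1, e2, e3] at key
  exact key

open Classical in
/-- **The second-moment bound (sites)**: `P_p(orientedSiteEvent) ≥ p · d^{2n} / SV d (1/p) n 0`. -/
theorem le_real_orientedSiteEvent [NeZero d] (p : unitInterval) (hp : 0 < (p : ℝ)) :
    (p : ℝ) * (d : ℝ) ^ (2 * n) / SV d (1 / p) n 0 ≤ (sitePercolation (Site d) p).real (orientedSiteEvent d n) := by
  have hreal : ∑ a : VIdx d n → Bool, wt (p : ℝ) a *
        (if ∃ w : Fin n → Fin d, ∀ y ∈ vsetOf w, a y = true then (1 : ℝ) else 0) ≤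
      (sitePercolation (Site d) p).real (orientedSiteEvent d n) := by
    refine le_of_eq_of_le ?_ (sum_le_site_real p determinedBy_orientedSiteEvent)
    refine Finset.sum_congr rfl fun a _ => ?_
    congr 1
    exact if_congr (liftB_mem_iff a).symm rfl rfl
  refine le_trans ?_ hreal
  have h1 := first_moment_site (d := d) (n := n) (p : ℝ)
  have h2 := second_moment_site (d := d) (n := n) hp
  have hcs := moment_ineq_site (d := d) (n := n) p.2.1 p.2.2
  rw [h1, h2] at hcs
  have hS : 0 < SV d (1 / p) n 0 := by
    unfold SV
    refine Finset.sum_pos (fun w _ => Finset.sum_pos (fun w' _ => by positivity) univ_nonempty) univ_nonempty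
  have hpn : (0 : ℝ) < (p : ℝ) ^ (2 * n + 1) := pow_pos hp _
  rw [div_le_iff₀ hS]
  have e2 : ((d : ℝ) ^ n * (p : ℝ) ^ (n + 1)) ^ 2 = (p : ℝ) ^ (2 * n + 1) * ((p : ℝ) * (d : ℝ) ^ (2 * n)) := by ring
  rw [e2, mul_assoc] at hcs
  have := le_of_mul_le_mul_left hcs hpn
  linarith

/-- **The bridge (sites)**: `p · d^{2n} / SV d (1/p) n 0 ≤ P_p(0 ⟷ ∂ⁱⁿB(0, n) in B(0, n))` on `ℤ^d`. -/
theorem le_real_exitEvent [NeZero d] (p : unitInterval) (hp : 0 < (p : ℝ)) (n : ℕ) :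
    (p : ℝ) * (d : ℝ) ^ (2 * n) / SV d (1 / p) n 0 ≤
      (sitePercolation (Site d) p).real (exitEvent (zdGraph d) (DCTQ.ball (zdGraph d) (0 : Site d) n) (0 : Site d)) :=
  (le_real_orientedSiteEvent p hp).trans
    (measureReal_mono (fun _ hE => exitEvent_of_orientedSiteEvent hE) (measure_ne_top _ _))

end Summit.CriticalPhenomena.PercolationContinuityZ3.Theorems.Pcint.OSM

end
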